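import Summits.Parity.GeneralizedHardyLittlewood.Theses.FordMaynardSieveConst01651
import Summits.Parity.GeneralizedHardyLittlewood.Theorems.FordMaynardSieveConst01651SieveConst01651StubHkPieces
import Summits.Parity.GeneralizedHardyLittlewood.Theorems.FordMaynardSieveConst01651SieveConst01651FiveGeneric
import Summits.Parity.GeneralizedHardyLittlewood.Theorems.FordMaynardSieveConst01651SieveConst01651CertValue
import Literature.Barriers.Parity.FriedlanderGranvilleUniformityTools
import Literature.NumberTheory.Sieve.FordMaynardTypeIBound
import Summits.Parity.GeneralizedHardyLittlewood.Theorems.FordMaynardSieveConst01651SieveConst01651StubSignClauseFive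
import Summits.Parity.GeneralizedHardyLittlewood.Theorems.FordMaynardSieveConst01651SieveConst01651StubCertValuePos
import Summits.Parity.GeneralizedHardyLittlewood.Theorems.FordMaynardSieveConst01651SieveConst01651TypeIIRegion
import HarnessLib

/-!
# Route `FordMaynardSieveConst01651`, target `SieveConst01651` (stmt-Parity-19185): line `sieve_decomposition` re-homed — the DEFINITIONS (file 1 of 13)

Definitions file of 13 of the VERBATIM re-homing under `Theorems/` of the registered line skeleton
`Summits/Parity/GeneralizedHardyLittlewood/Cruxes/SieveConst01651/Lines/sieve_decomposition.lean` (v21, sha16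
`ada6d0765119a11e`; author seat `linewriter-parity-smallroutes-1`, g0 v1–v20 / g1 v21): Ford–Maynard, Theorem 7.3 (a) at
`P = (1/2, 0, ν)` with CLOSED support, cut along arXiv:2407.14368 §7.2 / §6.2, composed down to the route target
`Summit.Parity.GeneralizedHardyLittlewood.Theses.FordMaynardSieveConst01651.SieveConst01651`.  Namespace
`Summit.Parity.GeneralizedHardyLittlewood.FordMaynardSieveConst01651SieveDecomposition` (fresh; the `Cruxes` copy keeps its own), files of
≤ 400 lines chained by import; the three registered stubs are replaced by their landed proofs
(`…StubSignClauseFive` p834287, `…StubCertValuePos` p837763, `…TypeIIRegion` p833045), so the skeleton's composition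
`SieveConst01651_of_stubs` (last part) is sorry-free.  Mathematics, statements and comments are the linewriter's; this
re-homing (hand `leafhand-parity-fordmaynardsieveco-2` g4) only moved the definitions (`Eset`, `sliceTest`, `mainG1`, `vk`,
the `Signature.*` statement abbreviations, `Phi`, `innerI`, `jumpSet`, `gval`, `symmExt`, `idxProd`, `gam`) into the first
file, added docstrings where missing, and renamed two unused binders.
Declarations in this part: `IsExc`, `Eset`, `SFset`, `NSFset`, `SFkset`, `sliceTest`, `mainG1`, `vk`, `Signature.stub_coneCertClosed`, `Signature.signLemma`, `Signature.tupleSumIntegral`, `Signature.injSumIntegral`, `Signature.VsumIntegral`, `Signature.sliceSymm`, `Phi`, `Signature.chamberSymm`, `Signature.windowPNT`, `Signature.integralMainTerm`, `Signature.VsumMainTerm`, `Signature.sliceMainTerm`, `Signature.sqfreeMainTerm`, `Signature.mainTerm`, `Signature.weightJumps`, `Signature.typeITerm`, `Signature.stub_typeIIRegion`, `Signature.stub_signClauseFive`, `Signature.stub_certValuePos`, `Signature.squarefullPatch`, `innerI`, `jumpSet`, `gval`, `symmExt`, `idxProd`, `gam`, `Signature.stub_hkPieces`.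

References: [FordMaynard2024PrimeSieves] K. Ford, J. Maynard, *On the theory of prime producing sieves*, arXiv:2407.14368,
Theorem 7.3 (a), Proposition 7.19, §6.2, §7.2, §8.2.
-/

noncomputable section

open Finset
open Literature.NumberTheory.Sieve Literature.NumberTheory.Sieve.FordMaynard Literature.Barriers.Parity.FordMaynard
open Summit.Parity.GeneralizedHardyLittlewood.FordMaynardSieveConst01651SieveConst01651
  (hfun Admissible hfun_apply hfun_of_ne pvec roughPart smoothPart Gwt Hwt window IsRough Nset Rset mem_window mem_Nset mem_Rset
   coneCert openSmall stub_hkPieces stub_coneCertClosed_of_residues' coneCert_signClause_five_of_generic)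

namespace Summit.Parity.GeneralizedHardyLittlewood.FordMaynardSieveConst01651SieveDecomposition

/-- `IsExc` — definition of the line skeleton `sieve_decomposition` (v21, seat `linewriter-parity-smallroutes-1`), re-homed verbatim. [folklore] -/
def IsExc (n : ℕ) : Prop :=
  (∃ p ∈ n.primeFactors, p ^ 2 ∣ n ∧ (p : ℝ) ≤ (n : ℝ) ^ (1 / 4 : ℝ)) ∨ ∃ p ∈ n.primeFactors, n = p ^ 2

/-- `Eset` — definition of the line skeleton `sieve_decomposition` (v21, seat `linewriter-parity-smallroutes-1`), re-homed verbatim. [folklore] -/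
def Eset (ν x : ℝ) : Finset ℕ := by
  classical exact (Nset ν x).filter IsExc

/-- `SFset` — definition of the line skeleton `sieve_decomposition` (v21, seat `linewriter-parity-smallroutes-1`), re-homed verbatim. [folklore] -/
def SFset (ν x : ℝ) : Finset ℕ := by
  classical exact (Nset ν x).filter Squarefree

/-- `NSFset` — definition of the line skeleton `sieve_decomposition` (v21, seat `linewriter-parity-smallroutes-1`), re-homed verbatim. [folklore] -/
def NSFset (ν x : ℝ) : Finset ℕ := by
  classical exact (Nset ν x).filter (fun n => ¬ Squarefree n)

/-- `SFkset` — definition of the line skeleton `sieve_decomposition` (v21, seat `linewriter-parity-smallroutes-1`), re-homed verbatim. [folklore] -/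
def SFkset (ν x : ℝ) (k : ℕ) : Finset ℕ := by
  classical exact (SFset ν x).filter (fun n => n.primeFactorsList.length = k)

open scoped Classical in

/-- `sliceTest` — definition of the line skeleton `sieve_decomposition` (v21, seat `linewriter-parity-smallroutes-1`), re-homed verbatim. [folklore] -/
def sliceTest (ν : ℝ) (g : VecFn) (k : ℕ) : (Fin k → ℝ) → ℝ :=
  fun x => if (∀ i, ν < x i ∧ x i < 1 - ν) ∧ Monotone x then starSum g k x / ∏ i, x i else 0

/-- `mainG1` — definition of the line skeleton `sieve_decomposition` (v21, seat `linewriter-parity-smallroutes-1`), re-homed verbatim. [folklore] -/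
def mainG1 (ν : ℝ) (g : VecFn) (k : ℕ) (x : ℝ) : (Fin k → ℝ) → ℝ :=
  mainG (hfun ν g k) (1 : ℕ).primeFactors.card k (uvec x 1) (Real.log (x / (2 * ((1 : ℕ) : ℝ))) / Real.log x)
    (Real.log ((⌊x⌋₊ : ℕ) : ℝ) / Real.log x)

/-- `vk` — definition of the line skeleton `sieve_decomposition` (v21, seat `linewriter-parity-smallroutes-1`), re-homed verbatim. [folklore] -/
def vk (k n : ℕ) : Fin k → ℝ := fun i => Real.log (n.primeFactorsList.getD i 0) / Real.log n

/-- Stub 0 (ccert, XL): the closed-support cone-data certificate at … -/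
def Signature.stub_coneCertClosed : Prop :=
  ∃ g₀ : VecFn, IsPiecewiseConstOnCone g₀ ∧ (∀ e : Fin 0 → ℝ, g₀ 0 e = 1) ∧
    (∀ (k : ℕ) (x : Fin k → ℝ), Monotone x → g₀ k x ≠ 0 →
      k = 0 ∨ ((∀ i, (1651 / 10000 : ℝ) < x i) ∧ ∑ i, x i ≤ 1 / 2)) ∧
    (∀ k : ℕ, 2 ≤ k → k ≤ 6 → ∀ x : Fin k → ℝ, Monotone x →
      (∀ i, (1651 / 10000 : ℝ) < x i ∧ x i < 1 - 1651 / 10000) → ∑ i, x i = 1 →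
        starSum g₀ k x ≤ 0) ∧
    0 < sieveBoundG1 (1651 / 10000) g₀

/-- FM Lemma 7.18 (c) REPAIRED (sign on `𝒩 ∖ ℰ`), on the divisor lattice … -/
def Signature.signLemma : Prop :=
  ∀ ν : ℝ, 0 < ν → ν < 1 / 4 → ∀ g : VecFn, Admissible ν g →
    ∀ n : ℕ, 2 ≤ n → ¬ n.Prime → IsRough ν n → ¬ IsExc n →
      ∑ d ∈ n.divisors, g d.primeFactorsList.length (pvec n d) ≤ 0

/-- Stub 1a (M, tree instantiation; v15 — replaces v14's … -/
def Signature.tupleSumIntegral : Prop :=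
  ∀ ν : ℝ, 0 < ν → ν < 1 / 4 → ∀ g : VecFn, Admissible ν g →
    ∀ k : ℕ, 2 ≤ k → k ≤ ⌊1 / ν⌋₊ →
      ∀ ε : ℝ, 0 < ε → ∃ x₀ : ℝ, ∀ x : ℝ, x₀ ≤ x →
        |primeTupleSum k x (mainG1 ν g k x) - primeTupleIntegral k x (mainG1 ν g k x)| ≤ ε * x / Real.log x

/-- Former stub (PROVED here; see the card). -/
def Signature.injSumIntegral : Prop :=
  ∀ ν : ℝ, 0 < ν → ν < 1 / 4 → ∀ g : VecFn, Admissible ν g →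
    ∀ k : ℕ, 2 ≤ k → k ≤ ⌊1 / ν⌋₊ →
      ∀ ε : ℝ, 0 < ε → ∃ x₀ : ℝ, ∀ x : ℝ, x₀ ≤ x →
        |injSum (hfun ν g k) x 1 ⌊x⌋₊ k - primeTupleIntegral k x (mainG1 ν g k x)| ≤ ε * x / Real.log x

/-- Former stub (PROVED here; see the card). -/
def Signature.VsumIntegral : Prop :=
  ∀ ν : ℝ, 0 < ν → ν < 1 / 4 → ∀ g : VecFn, Admissible ν g →
    ∀ k : ℕ, 2 ≤ k → k ≤ ⌊1 / ν⌋₊ →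
      ∀ ε : ℝ, 0 < ε → ∃ x₀ : ℝ, ∀ x : ℝ, x₀ ≤ x →
        |Vsum (hfun ν g k) x 1 ⌊x⌋₊
            - (1 / (k.factorial : ℝ)) * primeTupleIntegral k x (mainG1 ν g k x)| ≤ ε * x / Real.log x

/-- Former stub (PROVED here; see the card). -/
def Signature.sliceSymm : Prop :=
  ∀ ν : ℝ, 0 < ν → ν < 1 / 4 → ∀ g : VecFn, Admissible ν g →
    ∀ k : ℕ, 2 ≤ k → k ≤ ⌊1 / ν⌋₊ → ∀ x : ℝ,
      typeITerm (hfun ν g k) (1 : ℕ).primeFactors.card (uvec x 1) k = sliceIntegral k 1 (sliceTest ν g k)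

open scoped Classical in

/-- `Phi` — definition of the line skeleton `sieve_decomposition` (v21, seat `linewriter-parity-smallroutes-1`), re-homed verbatim. [folklore] -/
def Phi (ν : ℝ) (g : VecFn) (k : ℕ) : (Fin k → ℝ) → ℝ :=
  fun u => (if ∀ i, ν < u i then starSum g k u else 0) / ∏ i, u i

open scoped Classical in
/-- Former stub (PROVED here; see the card). -/
def Signature.chamberSymm : Prop :=
  ∀ (k : ℕ) (w M : ℝ) (Φ : (Fin k → ℝ) → ℝ), Measurable Φ → (∀ u, |Φ u| ≤ M) →
    (∀ (σ : Equiv.Perm (Fin k)) (u : Fin k → ℝ), Φ (u ∘ σ) = Φ u) →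
      sliceIntegral k w Φ = (k.factorial : ℝ) * sliceIntegral k w (fun u => if Monotone u then Φ u else 0)

/-- Former stub (PROVED here; see the card). -/
def Signature.windowPNT : Prop :=
  ∀ ε : ℝ, 0 < ε → ∃ x₀ : ℝ, ∀ x : ℝ, x₀ ≤ x →
    |(∫ w in Set.Ioc (Real.log (x / (2 * ((1 : ℕ) : ℝ))) / Real.log x) (Real.log ((⌊x⌋₊ : ℕ) : ℝ) / Real.log x), x ^ w / w)
        - ((windowPrimes x).card : ℝ)| ≤ ε * x / Real.log x

/-- Former stub (PROVED here; see the card). -/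
def Signature.integralMainTerm : Prop :=
  ∀ ν : ℝ, 0 < ν → ν < 1 / 4 → ∀ g : VecFn, Admissible ν g →
    ∀ k : ℕ, 2 ≤ k → k ≤ ⌊1 / ν⌋₊ →
      ∀ ε : ℝ, 0 < ε → ∃ x₀ : ℝ, ∀ x : ℝ, x₀ ≤ x →
        |(1 / (k.factorial : ℝ)) * primeTupleIntegral k x (mainG1 ν g k x)
            - sliceIntegral k 1 (sliceTest ν g k) * ((windowPrimes x).card : ℝ)| ≤ ε * x / Real.log x

/-- Former stub (PROVED here; see the card). -/
def Signature.VsumMainTerm : Prop :=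
  ∀ ν : ℝ, 0 < ν → ν < 1 / 4 → ∀ g : VecFn, Admissible ν g →
    ∀ k : ℕ, 2 ≤ k → k ≤ ⌊1 / ν⌋₊ →
      ∀ ε : ℝ, 0 < ε → ∃ x₀ : ℝ, ∀ x : ℝ, x₀ ≤ x →
        |Vsum (hfun ν g k) x 1 ⌊x⌋₊
            - sliceIntegral k 1 (sliceTest ν g k) * ((windowPrimes x).card : ℝ)| ≤ ε * x / Real.log x

/-- Former stub (PROVED here; see the card). -/
def Signature.sliceMainTerm : Prop :=
  ∀ ν : ℝ, 0 < ν → ν < 1 / 4 → ∀ g : VecFn, Admissible ν g →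
    ∀ k : ℕ, 2 ≤ k → k ≤ ⌊1 / ν⌋₊ →
      ∀ ε : ℝ, 0 < ε → ∃ x₀ : ℝ, ∀ x : ℝ, x₀ ≤ x →
        |∑ n ∈ SFkset ν x k, starSum g k (vk k n)
            - sliceIntegral k 1 (sliceTest ν g k) * ((windowPrimes x).card : ℝ)| ≤ ε * x / Real.log x

/-- Former stub (PROVED here; see the card). -/
def Signature.sqfreeMainTerm : Prop :=
  ∀ ν : ℝ, 0 < ν → ν < 1 / 4 → ∀ g : VecFn, Admissible ν g →
    ∀ ε : ℝ, 0 < ε → ∃ x₀ : ℝ, ∀ x : ℝ, x₀ ≤ x →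
      |∑ n ∈ SFset ν x, starSum g n.primeFactorsList.length (pvec n n)
          - (sieveBoundG1 ν g - 1) * ((windowPrimes x).card : ℝ)| ≤ ε * x / Real.log x

/-- Former stub (PROVED here; see the card). -/
def Signature.mainTerm : Prop :=
  ∀ ν : ℝ, 0 < ν → ν < 1 / 4 → ∀ g : VecFn, Admissible ν g →
    ∀ ε : ℝ, 0 < ε → ∃ x₀ : ℝ, ∀ x : ℝ, x₀ ≤ x →
      |∑ n ∈ Nset ν x, Hwt g ν n - (sieveBoundG1 ν g - 1) * ((windowPrimes x).card : ℝ)|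
        ≤ ε * x / Real.log x

/-- Former stub (PROVED here; see the card). -/
def Signature.weightJumps : Prop :=
  ∀ ν : ℝ, 0 < ν → ν < 1 / 4 → ∀ g : VecFn, Admissible ν g →
    ∃ C : ℝ, ∀ m : ℕ, 1 ≤ m → ∀ N : ℕ,
      (((Ico 1 N).filter (fun k : ℕ => Gwt g ν (m * (k + 1)) m ≠ Gwt g ν (m * k) m)).card : ℝ)
        ≤ C * (m.divisors.card : ℝ)

/-- Former stub (PROVED here; see the card). -/
def Signature.typeITerm : Prop :=
  ∀ ν : ℝ, 0 < ν → ν < 1 / 4 → ∀ g : VecFn, Admissible ν g →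
    ∃ K : ℝ, ∀ x : ℝ, 2 ≤ x → ∀ B : ℝ, 1 ≤ B → ∀ w : ℕ → ℝ, TypeI w x (1 / 2) B →
      |∑ n ∈ window x, w n * Hwt g ν n| ≤ K * x / Real.log x ^ B

/-- Stub 3 (XL print): FM Proposition 7.19 at `P = (1/2, 0, ν)` — v21 RE-TYPED with both halves of (w). -/
def Signature.stub_typeIIRegion : Prop :=
  ∀ ν : ℝ, 0 < ν → ν < 1 / 4 → ∀ g : VecFn, Admissible ν g →
    ∀ A : ℝ, 1 ≤ A → ∀ ϖ : ℝ, 1 ≤ ϖ → ∃ B₀ : ℝ, ∀ B : ℝ, B₀ ≤ B → ∃ K x₀ : ℝ, ∀ x : ℝ, x₀ ≤ x →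
      ∀ w : ℕ → ℝ, (∀ n : ℕ, -(x ^ (ν / 10)) ≤ w n) → GrowthBound w x ϖ → TypeI w x (1 / 2) B → TypeII w x 0 ν B →
        |∑ n ∈ Rset ν x, w n * Hwt g ν n| ≤ K * x / Real.log x ^ A

/-- Stub R1 (v21, FINITE): dim-5 generic sign clause of `coneCert`, couple form (= `hgen` of `stub_coneCertClosed_of_generic_five`). -/
def Signature.stub_signClauseFive : Prop :=
  ∀ x : Fin 5 → ℝ, Monotone x → (∀ i, (1651 / 10000 : ℝ) < x i ∧ x i < 1 - 1651 / 10000) →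
    ∑ i, x i = 1 → (∀ i, x i ∈ openSmall) →
    (∀ i j, i < j → x i + x j ≠ 8349 / 20000 ∧ x i + x j ≠ 1 / 2) →
    -4 + ∑ A ∈ (Finset.univ : Finset (Finset (Fin 5))).filter (fun A => A.card = 2),
      (coneCert A.card (fun i => x (A.orderEmbOfFin rfl i)) +
        coneCert Aᶜ.card (fun i => x (Aᶜ.orderEmbOfFin rfl i))) ≤ 0

/-- Stub R2 (v21, OPEN): the certificate value of `coneCert` is positive (kernel form: `coneCert_value_pos_iff`). -/
def Signature.stub_certValuePos : Prop :=
  0 < sieveBoundG1 (1651 / 10000) coneCert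

/-- The squarefull patch (no longer a stub: PROVED below as `squarefull_patch`). -/
def Signature.squarefullPatch : Prop :=
  ∀ ν : ℝ, 0 < ν → ν < 1 / 4 → ∀ x : ℝ, 2 ≤ x → ∀ B : ℝ, 0 < B → ∀ a : ℕ → ℝ, (∀ n, 0 ≤ a n) →
    TypeI (fun n => a n - 1) x (1 / 2) B →
      ∑ n ∈ Eset ν x, a n ≤ 4 * x ^ (1 - ν) + 2 * Real.sqrt x + 2 + 2 * x / Real.log x ^ B

/-- `innerI` — definition of the line skeleton `sieve_decomposition` (v21, seat `linewriter-parity-smallroutes-1`), re-homed verbatim. [folklore] -/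
def innerI (w : ℕ → ℝ) (x : ℝ) (I : ℕ → ℕ × ℕ) (m : ℕ) : ℝ :=
  ∑ n ∈ (Icc (I m).1 (I m).2).filter (fun n : ℕ => x / 2 < (m * n : ℝ) ∧ (m * n : ℝ) ≤ x), w (m * n)

/-- `jumpSet` — definition of the line skeleton `sieve_decomposition` (v21, seat `linewriter-parity-smallroutes-1`), re-homed verbatim. [folklore] -/
def jumpSet {α : Type*} [DecidableEq α] (f : ℕ → α) (N : ℕ) : Finset ℕ :=
  (Ico 1 N).filter (fun k => f (k + 1) ≠ f k)

/-- `gval` — definition of the line skeleton `sieve_decomposition` (v21, seat `linewriter-parity-smallroutes-1`), re-homed verbatim. [folklore] -/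
def gval (g : VecFn) (n e : ℕ) : ℝ := g e.primeFactorsList.length (pvec n e)

/-- `symmExt` — definition of the line skeleton `sieve_decomposition` (v21, seat `linewriter-parity-smallroutes-1`), re-homed verbatim. [folklore] -/
def symmExt (g₀ : VecFn) : VecFn := fun k x => g₀ k (x ∘ ⇑(Tuple.sort x))

/-- `idxProd` — definition of the line skeleton `sieve_decomposition` (v21, seat `linewriter-parity-smallroutes-1`), re-homed verbatim. [folklore] -/
def idxProd (n : ℕ) (A : Finset (Fin n.primeFactorsList.length)) : ℕ := ∏ i ∈ A, n.primeFactorsList.get i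

/-- `gam` — definition of the line skeleton `sieve_decomposition` (v21, seat `linewriter-parity-smallroutes-1`), re-homed verbatim. [folklore] -/
def gam (g : VecFn) (s : Multiset ℝ) : ℝ := g s.toList.length s.toList.get

open scoped Classical in
/-- Former stub 1a′ (LANDED BY NAME: `…StubHkPieces.stub_hkPieces`, p828729). -/
def Signature.stub_hkPieces : Prop :=
  ∀ ν : ℝ, 0 < ν → ν < 1 / 4 → ∀ g : VecFn, Admissible ν g → ∀ k m : ℕ,
    ∃ (n : ℕ) (Pc : Fin n → Set (Fin m → ℝ)) (c : Fin n → ℝ),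
      (∀ j, Convex ℝ (Pc j) ∧ MeasurableSet (Pc j)) ∧
      ∀ v, hfun ν g k m v = ∑ j, if v ∈ Pc j then c j else 0

end Summit.Parity.GeneralizedHardyLittlewood.FordMaynardSieveConst01651SieveDecomposition

end
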